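import Literature.MathematicalPhysics.QuantumFieldTheory.Balaban1983to89.B4ThmRegionPairEta
import Literature.MathematicalPhysics.QuantumFieldTheory.Balaban1983to89.B4RegionPairGreen
import Literature.MathematicalPhysics.QuantumFieldTheory.Balaban1983to89.B4TorusRegionLift

/-!
# `Balaban1983to89.B4RegionDecoupling` — [Balaban1983RegularityDecay] (1.3)–(1.6), (1.11): NEUMANN DECOUPLING OF THE
# GREEN's FUNCTION `G_k(Ω₀, A)` ACROSS A SEPARATED SUB-REGION — if no bond of `Ω₀` joins `Ω ⊂ Ω₀` to `Ω₀ ∖ Ω` (the sub-region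
# is a union of connected components of `Ω₀`), then `G_k(Ω₀,A)` read on `Ω` IS `G_k(Ω,A)` applied to the restriction,
# `D^η_{A,μ}` likewise, `δG_k(Ω,Ω₀,A) = 0`, and nearest-neighbour contours of `Ω₀` from a site of `Ω` stay in `Ω`
# (with the same parallel transport)

statement-level skeleton of published theorems with citation tags; proofs where landed; nothing here is a claim about the Yang–Mills mass gap

CITATION HEADER.  T. Bałaban, *Regularity and decay of lattice Green's functions*, Commun. Math. Phys. **89** (1983)
571–597, doi:10.1007/bf01214744 [Balaban1983RegularityDecay] (cell paper B4; held text
`paper:balaban1983-cmp89-regularity-decay`, journal page = PDF page + 570; p. 572 [PDF 2] (1.3)–(1.6), p. 573 [PDF 3]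
(1.11), p. 589 [PDF 19] «separating subsets of Ω by the Neumann boundary conditions»).  Seat `pub-ymgap-dag-p3` gen 4
(Track A, YM-PLAN §2 node N01 = [B4]; HOME `run/shared/lean/pub/pub-ymgap/`): the FIRST BRICK of the seat's route to the
`rect` residual (i) of N01's cross-read — the printed waiver «for rectangular parallelepipeds, the inequalities hold
without any restrictions on the points x, x′» for parallelepipeds of `T_η` that WRAP AROUND in some directions (bands):
r01 g9's periodic lift of such a band is a union of SEPARATED lattice parallelepipeds, on which the Theorem's members must
be read component by component (this file), each component being a box of the r04∕p17 lineage (later files).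
Imports: r01 g8 `B4ThmRegionPairEta` (the pair instances `RegionPairInst`: `GΩ`, `G₀`, `DΩ`, `D₀`, `resR`, `extR`,
`deltaV`), r01 g6 `B4RegionPairGreen` (`regOp`, `pairGreen` = `pad G_k(Ω,A) + pad G_k(Ω₀∖Ω,A)` inverting `Ω₀`'s
operator CUT across `∂Ω`, `pairGreen_mulVec_incl`), with p17's `B4CubeOpReindex.cutWt ∕ pad` and r04's
`B4RegionCubeCarrier.incl ∕ inReg`.

WHAT IS PRINTED.  p. 572 [PDF 2], (1.3): «⟨φ, (−Δ^{η,N}_{A,Ω})φ⟩ = Σ_{b⊂Ω} η^d |η^{−1}(U(A_b)φ(b₊) − φ(b₋))|², where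
the summation is over the set of all bonds b = ⟨b₋, b₊⟩ with end-points b₋, b₊ in Ω» (Neumann conditions: no bond
leaves `Ω`); (1.6) `G_k(Ω,A) = (−Δ^{η,N}_{A,Ω} + m² + aP_k(A))^{−1}`; p. 573 (1.11) `δG_k(Ω,Ω₀,A) = G_k(Ω,A) − G_k(Ω₀,A)`;
p. 589 «separating subsets of Ω by the Neumann boundary conditions».  The decoupling below is the elementary
consequence of (1.3)–(1.6) for a sub-region met by NO bond of `Ω₀ ∖ Ω` (and whose unit blocks, being whole blocks of
`Ω₀`, carry the same averaging operators (1.4)): the operator (1.6) of `Ω₀` is then the direct sum of those of `Ω` and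
`Ω₀ ∖ Ω` — our reading device for the bands, not a numbered statement of the print.

WHAT THIS MODULE PROVES (kernel, sorry-free, theorems only).  Lattice units of the lineage: fine mesh `n ≥ 1`, unit
labels `Ωc ⊆ Ω₀c`, fine regions `fineDom n Ωc ⊆ fineDom n Ω₀c`, inclusion `incl`; SEPARATION hypothesis
`hsep : ∀ x ∈ fineDom n Ωc, ∀ z ∈ fineDom n Ω₀c, z ∈ nbrs x → z ∈ fineDom n Ωc` (no nearest-neighbour bond of the
fine lattice joins `Ω` to `Ω₀ ∖ Ω`); `label_separated` — it follows from the same condition on unit LABELS.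
* §1 `cutWt_inReg_eq_regWt` — under `hsep` the bond weights (1.3) of `Ω₀` CUT across `∂Ω` are the bond weights of `Ω₀`
  (nothing to cut); `inv_regOp_eq_pairGreen` — hence `G_k(Ω₀,A) = pad G_k(Ω,A) + pad G_k(Ω₀∖Ω,A)` (r01 g6's `pairGreen`),
  for every bond configuration `B`, `a′ > 0`, `m² ≥ 0`; **`inv_regOp_mulVec_incl`** — `(G_k(Ω₀,A)f)(x) = (G_k(Ω,A)(f|_Ω))(x)`
  at every site `x ∈ Ω`; `inv_regOp_mulVec_incl_of_support` — in particular `G_k(Ω₀,A)f = 0` on `Ω` for `f` supported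
  off `Ω`.
* §2 ON r01's PAIR INSTANCES (`RegionPairInst`, the carriers of `regionPairFam`): **`resR_G₀_mulVec`**
  (`(G_k(Ω₀,A)g)|_Ω = G_k(Ω,A)(g|_Ω)`), **`deltaV_eq_zero`** (`δG_k(Ω,Ω₀,A)f = 0` for every `f : Ω → ℝ^N`),
  `fld_D₀_mulVec_incl` (`(D^η_{A,μ}w)(x) = (D^η_{A,μ}(w|_Ω))(x)` on `Ω`, both sides `0` when the bond `⟨x, x+ηe_μ⟩` leaves
  `Ω` — it then leaves `Ω₀` too), and the vanishing of the three `δ`-functionals of `regionPairFam` (`dvalG`, `dvalDG`,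
  `dlhs19`) — so `Ineq111_112` holds at a separated instance for any constants with `c₀ ≥ 0` (`ineq111_112_of_separated`).
* §3 CONTOURS: `inReg_of_isNNChain` (a nearest-neighbour chain of `Ω₀` starting in `Ω` stays in `Ω`),
  `exists_chain_of_isNNChain` (it is the image under `incl` of a chain of `Ω` with the same end point), `transport_map_incl`
  (the parallel transports `U(A(Γ))` agree), `isNNChain_map_incl` ∕ `pathEnd_map_incl`.
HONEST SCOPE.  Finite-dimensional bookkeeping on the lineage's carriers (abelian one-parameter flow `F.U`, bond
configurations `B` read as `B u.1 v.1`, component fields `A_c` via `compField`, staircase block contours); no analytic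
estimate; the separation hypothesis is OURS (it holds for the components of the periodic lift of a torus band, the
intended use).  No definition, no `Prop` fact, no `sorry`; axioms standard.  Count-neutral for YM-PLAN (typed 28∕28;
discharged count unmoved); nothing here concerns the continuum limit, ℝ⁴, OS axioms, a mass gap or the Clay problem.
-/

namespace Literature.MathematicalPhysics.QuantumFieldTheory.Balaban1983to89.B4RegionDecoupling

open Literature.MathematicalPhysics.QuantumFieldTheory.Balaban1983to89
open Literature.MathematicalPhysics.QuantumFieldTheory.Balaban1983to89.B4 (EtaSetting Ineq111_112)
open Literature.MathematicalPhysics.QuantumFieldTheory.Balaban1983to89.B4Reflection242 (blk nbrs mem_nbrs nbrs_comm)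
open Literature.MathematicalPhysics.QuantumFieldTheory.Balaban1983to89.B4GaugeCovariance
open Literature.MathematicalPhysics.QuantumFieldTheory.Balaban1983to89.B4Lower18 (fineDom mem_fineDom)
open Literature.MathematicalPhysics.QuantumFieldTheory.Balaban1983to89.B4Lower18Regular (e1)
open Literature.MathematicalPhysics.QuantumFieldTheory.Balaban1983to89.B4Lower18RegularRegion (regWt rBlkWt rbaseEmb
  rstairContour compField)
open Literature.MathematicalPhysics.QuantumFieldTheory.Balaban1983to89.B4Lemma21Region (regionOp regionDeriv siteNorm
  covDeriv fld_covDeriv_mulVec_of_not_mem)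
open Literature.MathematicalPhysics.QuantumFieldTheory.Balaban1983to89.B4Lemma22Reduce231 (siteNorm_zero supN_nonneg
  fld_zero siteNorm_nonneg)
open Literature.MathematicalPhysics.QuantumFieldTheory.Balaban1983to89.B4Lemma22HolderBox (IsNNChain)
open Literature.MathematicalPhysics.QuantumFieldTheory.Balaban1983to89.B4Eq221L2FactorRegion (acBond)
open Literature.MathematicalPhysics.QuantumFieldTheory.Balaban1983to89.B4RegionCubeCarrier (incl inReg inReg_iff
  incl_injective fineDom_mono)
open Literature.MathematicalPhysics.QuantumFieldTheory.Balaban1983to89.B4CubeOpReindex (cutWt pad)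
open Literature.MathematicalPhysics.QuantumFieldTheory.Balaban1983to89.B4LpNormTransfer (pad_mulVec_apply_img)
open Literature.MathematicalPhysics.QuantumFieldTheory.Balaban1983to89.B4RegionPairGreen (regOp pairGreen pairGreen_mul
  pairGreen_mulVec_incl)
open Literature.MathematicalPhysics.QuantumFieldTheory.Balaban1983to89.B4ThmRegionPairEta (RegionPairInst regionPairFam)
open scoped Matrix

noncomputable section

variable {d : ℕ} {ι : Type} [Fintype ι] [DecidableEq ι]

/-! ## §1. Separated sub-regions: nothing to cut, so `G_k(Ω₀,A)` is the padded direct sum -/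

section Lattice

variable (F : OrthFlow ι) (κ : ℝ) {n : ℕ} (hn : 1 ≤ n) (Ω₀c Ωc : Finset (Fin (d + 1) → ℤ)) (hsub : Ωc ⊆ Ω₀c)

omit [Fintype ι] [DecidableEq ι] in
include hn in
/-- **SEPARATION FROM THE UNIT LABELS**: if every unit label of `Ω₀` within sup-distance `1` of a label of `Ω` lies in
`Ω`, then no nearest-neighbour bond of the fine lattice joins `Ω` to `Ω₀ ∖ Ω` (the block label of a fine neighbour
differs by at most one in each coordinate, r01 g9's `abs_blk_sub_blk_le_of_nbrs`). [cite: Balaban1983RegularityDecay, (1.1), (1.3) p.572 (dictionary: blocks and bonds)] -/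
theorem label_separated
    (hlab : ∀ y ∈ Ωc, ∀ y' ∈ Ω₀c, (∀ ν, |y' ν - y ν| ≤ 1) → y' ∈ Ωc) :
    ∀ x ∈ fineDom n Ωc, ∀ z ∈ fineDom n Ω₀c, z ∈ nbrs x → z ∈ fineDom n Ωc := by
  intro x hx z hz hzx
  rw [mem_fineDom hn] at hx hz ⊢
  exact hlab (blk n x) hx (blk n z) hz fun ν => B4TorusRegionLift.abs_blk_sub_blk_le_of_nbrs hn hzx ν

variable (hsep : ∀ x ∈ fineDom n Ωc, ∀ z ∈ fineDom n Ω₀c, z ∈ nbrs x → z ∈ fineDom n Ωc)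

omit [Fintype ι] [DecidableEq ι] in
include hn hsep in
/-- **NOTHING TO CUT**: under separation, the bond weights (1.3) of `Ω₀` cut across `∂Ω` (p17's `cutWt` at the site
predicate `inReg n Ωc`) ARE the bond weights of `Ω₀`. [cite: Balaban1983RegularityDecay, (1.3) p.572 «bonds … with end-points b₋, b₊ in Ω»] -/
theorem cutWt_inReg_eq_regWt :
    cutWt (inReg n Ωc) (regWt n (fineDom n Ω₀c)) = regWt n (fineDom n Ω₀c) := by
  funext z z'
  by_cases hzz : z'.1 ∈ nbrs z.1
  · have hiff : inReg n Ωc z ↔ inReg n Ωc z' := by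
      constructor
      · intro hz
        exact (mem_fineDom hn).1 (hsep z.1 ((mem_fineDom hn).2 hz) z'.1 z'.2 hzz)
      · intro hz'
        exact (mem_fineDom hn).1 (hsep z'.1 ((mem_fineDom hn).2 hz') z.1 z.2 (nbrs_comm.1 hzz))
    simp only [cutWt, if_pos hiff]
  · have h0 : regWt n (fineDom n Ω₀c) z z' = 0 := by
      simp only [regWt, if_neg hzz, mul_zero]
    simp only [cutWt, h0, ite_self]

include hsep in
/-- **`G_k(Ω₀,A) = pad G_k(Ω,A) + pad G_k(Ω₀∖Ω,A)`** for a separated sub-region (every bond configuration `B`,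
`a′ > 0`, `m² ≥ 0`): r01 g6's `pairGreen` inverts `Ω₀`'s operator cut across `∂Ω`, which under separation is `Ω₀`'s
operator itself. [cite: Balaban1983RegularityDecay, (1.6) p.572, (1.11) p.573; p.589 «separating subsets of Ω by the Neumann boundary conditions»] -/
theorem inv_regOp_eq_pairGreen {m2 a' : ℝ} (ha' : 0 < a') (hm : 0 ≤ m2)
    (B : (Fin (d + 1) → ℤ) → (Fin (d + 1) → ℤ) → ℝ) :
    (regOp F κ hn Ω₀c m2 a' B)⁻¹ = pairGreen F κ hn Ω₀c Ωc hsub m2 a' B := by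
  have h := pairGreen_mul F κ hn Ω₀c Ωc hsub ha' hm B
  rw [cutWt_inReg_eq_regWt hn Ω₀c Ωc hsep] at h
  exact Matrix.inv_eq_left_inv h

include hsep in
/-- **DECOUPLING OF THE GREEN's FUNCTION**: at every site `x ∈ Ω`, `(G_k(Ω₀,A)f)(x) = (G_k(Ω,A)(f|_Ω))(x)` — for a
separated sub-region the Green's function of `Ω₀` read on `Ω` is the Green's function of `Ω` applied to the restriction
(every bond configuration `B`, `a′ > 0`, `m² ≥ 0`). [cite: Balaban1983RegularityDecay, (1.3)–(1.6) p.572, (1.11) p.573] -/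
theorem inv_regOp_mulVec_incl {m2 a' : ℝ} (ha' : 0 < a') (hm : 0 ≤ m2)
    (B : (Fin (d + 1) → ℤ) → (Fin (d + 1) → ℤ) → ℝ) (f : ↥(fineDom n Ω₀c) × ι → ℝ) (a : ↥(fineDom n Ωc)) (i : ι) :
    ((regOp F κ hn Ω₀c m2 a' B)⁻¹ *ᵥ f) (incl hn hsub a, i)
      = ((regOp F κ hn Ωc m2 a' B)⁻¹ *ᵥ fun q : ↥(fineDom n Ωc) × ι => f (incl hn hsub q.1, q.2)) (a, i) := by
  rw [inv_regOp_eq_pairGreen F κ hn Ω₀c Ωc hsub hsep ha' hm B]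
  exact pairGreen_mulVec_incl F κ hn Ω₀c Ωc hsub m2 a' B f a i

include hsep in
/-- … in particular `G_k(Ω₀,A)f` VANISHES on `Ω` for a source supported off `Ω`. [cite: Balaban1983RegularityDecay, (1.3)–(1.6) p.572 (Neumann decoupling)] -/
theorem inv_regOp_mulVec_incl_of_support {m2 a' : ℝ} (ha' : 0 < a') (hm : 0 ≤ m2)
    (B : (Fin (d + 1) → ℤ) → (Fin (d + 1) → ℤ) → ℝ) (f : ↥(fineDom n Ω₀c) × ι → ℝ)
    (hf : ∀ (a : ↥(fineDom n Ωc)) (i : ι), f (incl hn hsub a, i) = 0) (a : ↥(fineDom n Ωc)) (i : ι) :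
    ((regOp F κ hn Ω₀c m2 a' B)⁻¹ *ᵥ f) (incl hn hsub a, i) = 0 := by
  rw [inv_regOp_mulVec_incl F κ hn Ω₀c Ωc hsub hsep ha' hm B f a i]
  have h0 : (fun q : ↥(fineDom n Ωc) × ι => f (incl hn hsub q.1, q.2)) = 0 := by
    funext q; exact hf q.1 q.2
  rw [h0, Matrix.mulVec_zero, Pi.zero_apply]

/-! ### Contours: a nearest-neighbour chain of `Ω₀` starting in `Ω` stays in `Ω` -/

omit [Fintype ι] [DecidableEq ι] in
include hn hsep in
/-- every site of a nearest-neighbour chain of `Ω₀` that starts at a site of `Ω` lies in `Ω`. [cite: Balaban1983RegularityDecay, p.573 «Γ_{x,x′} a shortest contour connecting these points» (dictionary: contours of a separated component)] -/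
theorem inReg_of_isNNChain :
    ∀ (x : ↥(fineDom n Ω₀c)) (L : List ↥(fineDom n Ω₀c)), inReg n Ωc x → IsNNChain x L → ∀ z ∈ L, inReg n Ωc z := by
  intro x L
  induction L generalizing x with
  | nil => intro _ _ z hz; simp at hz
  | cons y L ih =>
      intro hx hL z hz
      obtain ⟨hy, hL'⟩ := hL
      have hy' : inReg n Ωc y :=
        (mem_fineDom hn).1 (hsep x.1 ((mem_fineDom hn).2 hx) y.1 y.2 hy)
      rcases List.mem_cons.1 hz with rfl | hz'
      · exact hy'
      · exact ih y hy' hL' z hz'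

omit [Fintype ι] [DecidableEq ι] in
/-- a nearest-neighbour chain of `Ω` read on the sites of `Ω₀` is a nearest-neighbour chain with the corresponding end
point (r01 g8's private lemma, re-proved). [cite: Balaban1983RegularityDecay, p.573 (dictionary: contours)] -/
theorem isNNChain_map_incl :
    ∀ (a : ↥(fineDom n Ωc)) (l : List ↥(fineDom n Ωc)), IsNNChain a l →
      IsNNChain (incl hn hsub a) (l.map (incl hn hsub)) ∧
        pathEnd (incl hn hsub a) (l.map (incl hn hsub)) = incl hn hsub (pathEnd a l) := by
  intro a l
  induction l generalizing a with
  | nil => exact fun _ => ⟨trivial, rfl⟩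
  | cons b l ih =>
      intro hl
      obtain ⟨hb, hl'⟩ := hl
      exact ⟨⟨hb, (ih b hl').1⟩, (ih b hl').2⟩

omit [Fintype ι] [DecidableEq ι] in
include hsep in
/-- **EVERY CHAIN OF `Ω₀` FROM A SITE OF `Ω` IS THE IMAGE OF A CHAIN OF `Ω`** (separated sub-region), with the same
length and the corresponding end point. [cite: Balaban1983RegularityDecay, p.573 (dictionary: contours of a separated component)] -/
theorem exists_chain_of_isNNChain (a : ↥(fineDom n Ωc)) (L : List ↥(fineDom n Ω₀c))
    (hL : IsNNChain (incl hn hsub a) L) :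
    ∃ l : List ↥(fineDom n Ωc), L = l.map (incl hn hsub) ∧ IsNNChain a l ∧
      pathEnd (incl hn hsub a) L = incl hn hsub (pathEnd a l) := by
  induction L generalizing a with
  | nil => exact ⟨[], rfl, trivial, rfl⟩
  | cons y L ih =>
      obtain ⟨hy, hL'⟩ := hL
      have hy' : y.1 ∈ fineDom n Ωc :=
        hsep a.1 a.2 y.1 y.2 hy
      have hyeq : y = incl hn hsub ⟨y.1, hy'⟩ := Subtype.ext rfl
      obtain ⟨l, hl, hch, hend⟩ := ih ⟨y.1, hy'⟩ (by exact hL')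
      refine ⟨⟨y.1, hy'⟩ :: l, ?_, ⟨hy, hch⟩, ?_⟩
      · rw [List.map_cons, ← hl]
        exact congrArg (fun t => t :: L) hyeq
      · exact hend

/-- the parallel transports `U(A(Γ))` along a chain of `Ω` and along its image in `Ω₀` agree (the bond function is read
through the sites: `acBond`). [cite: Balaban1983RegularityDecay, p.572 (1.4) «U(A(Γ))» (dictionary)] -/
theorem transport_map_incl (Ac : (Fin (d + 1) → ℤ) → Fin (d + 1) → ℝ) :
    ∀ (a : ↥(fineDom n Ωc)) (l : List ↥(fineDom n Ωc)),
      transport (fieldLink F κ (acBond Ω₀c Ac)) (incl hn hsub a) (l.map (incl hn hsub))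
        = transport (fieldLink F κ (acBond Ωc Ac)) a l := by
  intro a l
  induction l generalizing a with
  | nil => rfl
  | cons b l ih =>
      show fieldLink F κ (acBond Ω₀c Ac) (incl hn hsub a) (incl hn hsub b) * _ = fieldLink F κ (acBond Ωc Ac) a b * _
      rw [ih b]
      rfl

end Lattice

/-! ## §2. On r01's pair instances: `(G_k(Ω₀,A)g)|_Ω = G_k(Ω,A)(g|_Ω)`, `δG_k(Ω,Ω₀,A) = 0`, the derivative -/

section Pair

variable {ℓ : ℕ} {amin aplus m2plus : ℝ} (i : RegionPairInst d ℓ amin aplus m2plus) (F : OrthFlow ι)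
  (ha : 0 < amin) (hℓ : 1 ≤ ℓ)
  (hsep : ∀ x ∈ fineDom ((ℓ + 1) ^ i.k) i.Ωc, ∀ z ∈ fineDom ((ℓ + 1) ^ i.k) i.Ω₀c, z ∈ nbrs x →
    z ∈ fineDom ((ℓ + 1) ^ i.k) i.Ωc)

/-- the running coefficient of the instance is positive (`a_k > 0` for `a ≥ a₋ > 0`, `L ≥ 2`, `k ≥ 1`). [cite: Balaban1983RegularityDecay, (1.6) p.572 «a positive constant a»] -/
theorem aSeq_div_pos (ha : 0 < amin) (hℓ : 1 ≤ ℓ) :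
    0 < B1.aSeq i.a ((ℓ : ℝ) + 1) i.k * ((((ℓ + 1) ^ i.k : ℕ) : ℝ) ^ (d + 1))⁻¹ := by
  have hL : (1 : ℝ) < (ℓ : ℝ) + 1 := by
    have : (1 : ℝ) ≤ ℓ := by exact_mod_cast hℓ
    linarith
  have hn : (0 : ℝ) < (((ℓ + 1) ^ i.k : ℕ) : ℝ) := by
    exact_mod_cast Nat.pos_of_ne_zero (by positivity)
  exact mul_pos (B1.aSeq_pos (lt_of_lt_of_le ha i.ha1) hL i.hk) (by positivity)

/-- `G_k(Ω₀,A)` of the instance is r01 g6's `regOp⁻¹` at `κ = e/n`, `a′ = a_kη^{d+1}`, bond function `compField A_c`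
(definitional). [cite: Balaban1983RegularityDecay, (1.6) p.572 (dictionary)] -/
theorem G₀_eq :
    i.G₀ F = (regOp F (i.e / ((ℓ + 1) ^ i.k : ℕ)) (Nat.one_le_pow i.k (ℓ + 1) (Nat.succ_pos ℓ)) i.Ω₀c i.m2
      (B1.aSeq i.a ((ℓ : ℝ) + 1) i.k * ((((ℓ + 1) ^ i.k : ℕ) : ℝ) ^ (d + 1))⁻¹) (compField i.Ac))⁻¹ := rfl

/-- `G_k(Ω,A)` of the instance, likewise. [cite: Balaban1983RegularityDecay, (1.6) p.572 (dictionary)] -/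
theorem GΩ_eq :
    i.GΩ F = (regOp F (i.e / ((ℓ + 1) ^ i.k : ℕ)) (Nat.one_le_pow i.k (ℓ + 1) (Nat.succ_pos ℓ)) i.Ωc i.m2
      (B1.aSeq i.a ((ℓ : ℝ) + 1) i.k * ((((ℓ + 1) ^ i.k : ℕ) : ℝ) ^ (d + 1))⁻¹) (compField i.Ac))⁻¹ := rfl

include ha hℓ hsep in
/-- **`(G_k(Ω₀,A)g)|_Ω = G_k(Ω,A)(g|_Ω)`** at a SEPARATED pair instance, for every source `g` on `Ω₀`.
[cite: Balaban1983RegularityDecay, (1.3)–(1.6) p.572, (1.11) p.573] -/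
theorem resR_G₀_mulVec (g : ↥(fineDom ((ℓ + 1) ^ i.k) i.Ω₀c) × ι → ℝ) :
    i.resR (i.G₀ F *ᵥ g) = i.GΩ F *ᵥ i.resR g := by
  funext q
  obtain ⟨x, j⟩ := q
  show (i.G₀ F *ᵥ g) (incl _ i.hsub x, j) = (i.GΩ F *ᵥ i.resR g) (x, j)
  rw [G₀_eq, GΩ_eq, inv_regOp_mulVec_incl F _ (Nat.one_le_pow i.k (ℓ + 1) (Nat.succ_pos ℓ)) i.Ω₀c i.Ωc i.hsub hsep
    (aSeq_div_pos i ha hℓ) i.hm1 (compField i.Ac) g x j]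
  rfl

include ha hℓ hsep in
/-- **`δG_k(Ω,Ω₀,A) = 0` AT A SEPARATED PAIR INSTANCE**: `G_k(Ω,A)f − (G_k(Ω₀,A)Ef)|_Ω = 0` for every `f : Ω → ℝ^N`.
[cite: Balaban1983RegularityDecay, (1.11) p.573, (1.3)–(1.6) p.572] -/
theorem deltaV_eq_zero (f : ↥(fineDom ((ℓ + 1) ^ i.k) i.Ωc) × ι → ℝ) : i.deltaV F f = 0 := by
  show i.GΩ F *ᵥ f - i.resR (i.G₀ F *ᵥ i.extR f) = 0
  rw [resR_G₀_mulVec i F ha hℓ hsep, i.resR_extR, sub_self]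

include hsep in
/-- **THE DERIVATIVE DECOUPLES**: `(D^η_{A,μ}w)(x) = (D^η_{A,μ}(w|_Ω))(x)` at every `x ∈ Ω` (on a bond of `Ω` this is
r01's `DΩ_resR_apply`; if the bond `⟨x, x + ηe_μ⟩` leaves `Ω` it leaves `Ω₀` as well, by separation, and both sides
vanish). [cite: Balaban1983RegularityDecay, (1.3) p.572 (Neumann conditions)] -/
theorem fld_D₀_mulVec_incl (μ : Fin (d + 1)) (w : ↥(fineDom ((ℓ + 1) ^ i.k) i.Ω₀c) × ι → ℝ)
    (x : ↥(fineDom ((ℓ + 1) ^ i.k) i.Ωc)) :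
    fld (i.D₀ F μ *ᵥ w) (incl (Nat.one_le_pow i.k (ℓ + 1) (Nat.succ_pos ℓ)) i.hsub x)
      = fld (i.DΩ F μ *ᵥ i.resR w) x := by
  by_cases hx : x.1 + e1 μ ∈ fineDom ((ℓ + 1) ^ i.k) i.Ωc
  · funext j
    rw [fld_apply, fld_apply, i.DΩ_resR_apply F μ w x hx j]
  · have hx₀ : (incl (Nat.one_le_pow i.k (ℓ + 1) (Nat.succ_pos ℓ)) i.hsub x).1 + e1 μ
        ∉ fineDom ((ℓ + 1) ^ i.k) i.Ω₀c := by
      intro h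
      apply hx
      refine hsep x.1 x.2 _ h ?_
      exact mem_nbrs.2 ⟨μ, Or.inl rfl⟩
    rw [i.fld_DΩ_eq_zero F μ _ x hx]
    exact fld_covDeriv_mulVec_of_not_mem ((ℓ + 1) ^ i.k)
      (fieldLink F (i.e / ((ℓ + 1) ^ i.k : ℕ)) (acBond i.Ω₀c i.Ac)) w hx₀

variable {creg β : ℝ} {K : ℕ}

include ha hℓ hsep in
/-- the three `δ`-functionals of `regionPairFam` VANISH at a separated instance: `dvalG f x = 0`. [cite: Balaban1983RegularityDecay, (1.11)–(1.12) p.573 (dictionary)] -/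
theorem dvalG_eq_zero (f : ↥(fineDom ((ℓ + 1) ^ i.k) i.Ωc) × ι → ℝ) (x : ↥(fineDom ((ℓ + 1) ^ i.k) i.Ωc)) :
    (regionPairFam F d ℓ amin aplus m2plus creg β K i).dvalG f x = 0 := by
  show siteNorm (fld (i.deltaV F f) x) = 0
  rw [deltaV_eq_zero i F ha hℓ hsep, fld_zero, siteNorm_zero]

include ha hℓ hsep in
/-- `dvalDG μ f x = 0` at a separated instance. [cite: Balaban1983RegularityDecay, (1.11)–(1.12) p.573 (dictionary)] -/
theorem dvalDG_eq_zero (μ : Fin (d + 1)) (f : ↥(fineDom ((ℓ + 1) ^ i.k) i.Ωc) × ι → ℝ)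
    (x : ↥(fineDom ((ℓ + 1) ^ i.k) i.Ωc)) :
    (regionPairFam F d ℓ amin aplus m2plus creg β K i).dvalDG μ f x = 0 := by
  show siteNorm (fld (i.DΩ F μ *ᵥ i.deltaV F f) x) = 0
  rw [deltaV_eq_zero i F ha hℓ hsep, Matrix.mulVec_zero, fld_zero, siteNorm_zero]

include ha hℓ hsep in
/-- `dlhs19 α μ f x x′ = 0` at a separated instance (the Hölder quotient of the zero field). [cite: Balaban1983RegularityDecay, (1.11)–(1.12) p.573 (dictionary)] -/
theorem dlhs19_eq_zero (α : ℝ) (μ : Fin (d + 1)) (f : ↥(fineDom ((ℓ + 1) ^ i.k) i.Ωc) × ι → ℝ)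
    (x x' : ↥(fineDom ((ℓ + 1) ^ i.k) i.Ωc)) :
    (regionPairFam F d ℓ amin aplus m2plus creg β K i).dlhs19 α μ f x x' = 0 := by
  show i.holderQ F α μ (i.DΩ F μ *ᵥ i.deltaV F f) x x' = 0
  rw [deltaV_eq_zero i F ha hℓ hsep, Matrix.mulVec_zero]
  apply le_antisymm
  · refine i.holderQ_le F le_rfl fun l _ => ?_
    rw [fld_zero, fld_zero, Matrix.mulVec_zero, sub_zero, siteNorm_zero, mul_zero]
  · -- `holderQ` is a supremum of non-negative terms over a family containing `0`-bounded values
    unfold RegionPairInst.holderQ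
    refine Real.iSup_nonneg fun l => Real.iSup_nonneg fun _ => ?_
    exact mul_nonneg (Real.rpow_nonneg (div_nonneg (by positivity) (B4ContourShift.supNorm_nonneg _)) α)
      (siteNorm_nonneg _)

include ha hℓ hsep in
/-- **(1.11)–(1.12) HOLD TRIVIALLY AT A SEPARATED INSTANCE** (`δG = 0`), for every `α`, `δ₀`, `R₀` and every `c₀ ≥ 0`.
[cite: Balaban1983RegularityDecay, Theorem (1.11)–(1.12) p.573] -/
theorem ineq111_112_of_separated (α δ₀ c₀ R₀ : ℝ) (hc : 0 ≤ c₀) :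
    Ineq111_112 (regionPairFam F d ℓ amin aplus m2plus creg β K i) α δ₀ c₀ R₀ := by
  refine ⟨fun μ f x x' _ => ?_, fun μ f x _ => ⟨?_, ?_⟩⟩
  · rw [dlhs19_eq_zero i F ha hℓ hsep]
    exact mul_nonneg (mul_nonneg (mul_nonneg hc (Real.exp_pos _).le) (Real.exp_pos _).le) (supN_nonneg _)
  · rw [dvalDG_eq_zero i F ha hℓ hsep]
    exact mul_nonneg (mul_nonneg (mul_nonneg hc (Real.exp_pos _).le) (Real.exp_pos _).le) (supN_nonneg _)
  · rw [dvalG_eq_zero i F ha hℓ hsep]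
    exact mul_nonneg (mul_nonneg (mul_nonneg hc (Real.exp_pos _).le) (Real.exp_pos _).le) (supN_nonneg _)

end Pair

end

end Literature.MathematicalPhysics.QuantumFieldTheory.Balaban1983to89.B4RegionDecoupling
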